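import Summits.ValiantsHypothesis.ValiantsHypothesis.Theorems.LacunarySymmetroidMatrixDescartesKernelDefiniteJunctionBivariateEval
import Summits.ValiantsHypothesis.ValiantsHypothesis.Theorems.LacunarySymmetroidMatrixDescartesKernelDefiniteJunctionChain

/-!
# Kernel-definite junction, part 7: the bridge to the Newton chain, and NONSINGULAR JUNCTIONS ARE ADDITIVE

Helper file for the stub `stub_kernelDefiniteJunction` of the line `junction_ceiling` (crux `MatrixDescartes`,
stmt-ValiantsHypothesis-18050).

* `junction_count_of_seam` — THE BRIDGE: for a junction of `P = ∑ X^{d l} S l` and `Q = ∑ X^{e l} T l`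
  (`d, e` strictly increasing, `T 0 = S last`, far ends `S 0`, `T last` nonsingular), ANY admissible seam datum
  `(n₀, j₂, g, w)` for the coefficient array `F i j = [x^i y^j] det 𝓗` (parts 5–6) yields, eventually in `Λ`,
  `#{x > 0 : det H_Λ (x) = 0} ≤ Z•(det P) + Z•(E₂) + Z•(det Q)` with `E₂` the seam edge polynomial (part 4).
* `junction_additive_of_det_ne_zero` — if the junction letter `J = S last` is NONSINGULAR the trivial seam datum
  `(n₀, j₂, g, w) = (m ã, 0, 1, 1)` is admissible and `E₂` is a monomial: eventually `ζ(H_Λ) ≤ Z•(det P) + Z•(det Q)`.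
* `nonsingularJunctionAdditive` — the line's `NonsingularJunctionAdditive m` (all `m`), stated with the line's
  vocabulary (`posD`, `posM`, `pencil`, `junction`) unfolded; the line file closes it by `exact`.
The singular (kernel-definite) seam is part 8. Nothing here bears on `MatrixDescartes`, Conjecture B or VP ≠ VNP.
[folklore]
-/

-- `Summit.ValiantsHypothesis.ValiantsHypothesis.…` is the tree's mandated single-conjunct layout (Sub = Summit).
set_option linter.dupNamespace false
set_option autoImplicit false

namespace Summit.ValiantsHypothesis.ValiantsHypothesis.Theorems.LacunarySymmetroidMatrixDescartes.JunctionCeiling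

open Polynomial Finset Matrix Filter
open scoped BigOperators

/-- positive roots with multiplicity of a nonzero monomial: none. [folklore] -/
theorem countP_roots_C_mul_X_pow (c : ℝ) (hc : c ≠ 0) (n : ℕ) :
    (C c * (X : ℝ[X]) ^ n).roots.countP (fun t => 0 < t) = 0 := by
  rw [roots_C_mul_X_pow hc]
  refine Multiset.countP_eq_zero.2 fun x hx h => ?_
  have hx' := Multiset.mem_of_mem_nsmul hx
  rw [Multiset.mem_singleton] at hx'
  rw [hx'] at h
  exact lt_irrefl _ h

section Bridge

variable {m : ℕ} (K₁ K₂ : ℕ) (d : Fin (K₁ + 1) → ℕ) (S : Fin (K₁ + 1) → Matrix (Fin m) (Fin m) ℝ)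
  (e : Fin (K₂ + 1) → ℕ) (T : Fin (K₂ + 1) → Matrix (Fin m) (Fin m) ℝ)
  (H : Matrix (Fin m) (Fin m) (Polynomial ℝ[X]))
  (hH : ∀ i k, H i k = (∑ l : Fin (K₁ + 1), C (C (S l i k)) * X ^ (d l - d 0)) +
    ∑ l : Fin K₂, C (C (T l.succ i k) * X ^ (e l.succ - e 0)) * X ^ (d (Fin.last K₁) - d 0))

include hH

/-- **THE BRIDGE.** Any admissible seam datum for the coefficient array of `det 𝓗` bounds the positive roots of the
junction pencil by `Z•(det P) + Z•(E₂) + Z•(det Q)`, eventually in `Λ`. [folklore] -/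
theorem junction_count_of_seam (hd : StrictMono d) (he : StrictMono e) (h0 : T 0 = S (Fin.last K₁))
    (hS0 : (S 0).det ≠ 0) (hTl : (T (Fin.last K₂)).det ≠ 0)
    (n₀ j₂ g w : ℕ) (hg : 0 < g) (hw : 0 < w) (hn₀ : n₀ ≤ m * (d (Fin.last K₁) - d 0))
    (hj₂ : j₂ ≤ m * (e (Fin.last K₂) - e 0)) (hC : w * (m * (d (Fin.last K₁) - d 0) - n₀) = g * j₂)
    (hN2 : ∀ i j, ((det H).coeff i).coeff j ≠ 0 → w * i ≤ w * n₀ + g * j)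
    (hn00 : ((det H).coeff n₀).coeff 0 ≠ 0) (hI2 : ((det H).coeff (m * (d (Fin.last K₁) - d 0))).coeff j₂ ≠ 0)
    (E₂ : ℝ[X])
    (hE₂ : E₂ = ∑ i ∈ range (m * (d (Fin.last K₁) - d 0) + 1), ∑ j ∈ range (m * (e (Fin.last K₂) - e 0) + 1),
      C (if w * i = w * n₀ + g * j then ((det H).coeff i).coeff j else 0) * X ^ (i + j)) :
    ∀ᶠ Λ : ℝ in atTop,
      ((∑ l : Fin (K₁ + 1) ⊕ Fin K₂,
          (X : ℝ[X]) ^ (Sum.elim d (fun l : Fin K₂ => d (Fin.last K₁) + (e l.succ - e 0)) l) •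
            (Sum.elim S (fun l : Fin K₂ => (Λ⁻¹) ^ (e l.succ - e 0) • T l.succ) l).map C).det.roots.toFinset.filter
          (fun t => 0 < t)).card ≤
        (∑ l, (X : ℝ[X]) ^ d l • (S l).map C).det.roots.countP (fun t => 0 < t) +
          E₂.roots.countP (fun t => 0 < t) +
          (∑ l, (X : ℝ[X]) ^ e l • (T l).map C).det.roots.countP (fun t => 0 < t) := by
  set I : ℕ := m * (d (Fin.last K₁) - d 0) with hI
  set J : ℕ := m * (e (Fin.last K₂) - e 0) with hJ
  set F : ℕ → ℕ → ℝ := fun i j => ((det H).coeff i).coeff j with hFdef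
  have hF : ∀ i j, F i j = ((det H).coeff i).coeff j := fun i j => rfl
  have hFI : ∀ i j, F i j ≠ 0 → i ≤ I := by
    intro i j hij
    by_contra hlt
    apply hij
    rw [hF, coeff_eq_zero_of_natDegree_lt (lt_of_le_of_lt (natDegree_G_le K₁ K₂ d S e T H hH hd.monotone)
      (lt_of_not_ge hlt)), coeff_zero]
  have hFJ : ∀ i j, F i j ≠ 0 → j ≤ J := by
    intro i j hij
    by_contra hlt
    apply hij
    rw [hF, coeff_eq_zero_of_natDegree_lt (lt_of_le_of_lt (natDegree_coeff_G_le K₁ K₂ d S e T H hH he.monotone i)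
      (lt_of_not_ge hlt))]
  have h00 : F 0 0 ≠ 0 := by rw [hF, F_zero_zero K₁ K₂ d S e T H hH hd he]; exact hS0
  have hIJ : F I J ≠ 0 := by
    rw [hF, hI, coeff_G_top K₁ K₂ d S e T H hH hd h0, hJ, coeff_detQ_top K₂ e T he]
    exact hTl
  have hchain := newton_chain_ceiling F I J n₀ j₂ g w hg hw hn₀ hj₂ hC hFI hFJ hN2 h00 hn00 hI2 hIJ
    (fun Λ => ∑ i ∈ range (I + 1), ∑ j ∈ range (J + 1), C (F i j * (Λ⁻¹) ^ j) * X ^ (i + j))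
    (fun _ => rfl) _ E₂ _ rfl hE₂ rfl
  refine hchain.mono fun Λ hΛ => ?_
  rw [det_junction_eq K₁ K₂ d S e T H hH F hF hd.monotone he.monotone Λ, card_posRoots_X_pow_mul,
    det_pencil_shift d S hd.monotone, countP_roots_X_pow_mul, det_pencil_shift e T he.monotone,
    countP_roots_X_pow_mul, ← edgeOne_eq_det K₁ K₂ d S e T H hH F hF hd.monotone he,
    ← edgeThree_eq_det K₁ K₂ d S e T H hH F hF hd he.monotone h0]
  exact hΛ

/-- **Nonsingular junction letter ⇒ additive.** [folklore] -/
theorem junction_additive_of_det_ne_zero (hd : StrictMono d) (he : StrictMono e) (h0 : T 0 = S (Fin.last K₁))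
    (hS0 : (S 0).det ≠ 0) (hJ : (S (Fin.last K₁)).det ≠ 0) (hTl : (T (Fin.last K₂)).det ≠ 0) :
    ∀ᶠ Λ : ℝ in atTop,
      ((∑ l : Fin (K₁ + 1) ⊕ Fin K₂,
          (X : ℝ[X]) ^ (Sum.elim d (fun l : Fin K₂ => d (Fin.last K₁) + (e l.succ - e 0)) l) •
            (Sum.elim S (fun l : Fin K₂ => (Λ⁻¹) ^ (e l.succ - e 0) • T l.succ) l).map C).det.roots.toFinset.filter
          (fun t => 0 < t)).card ≤
        (∑ l, (X : ℝ[X]) ^ d l • (S l).map C).det.roots.countP (fun t => 0 < t) +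
          (∑ l, (X : ℝ[X]) ^ e l • (T l).map C).det.roots.countP (fun t => 0 < t) := by
  set I : ℕ := m * (d (Fin.last K₁) - d 0) with hI
  set J : ℕ := m * (e (Fin.last K₂) - e 0) with hJdef
  have hFI : ∀ i j, ((det H).coeff i).coeff j ≠ 0 → i ≤ I := by
    intro i j hij
    by_contra hlt
    apply hij
    rw [coeff_eq_zero_of_natDegree_lt (lt_of_le_of_lt (natDegree_G_le K₁ K₂ d S e T H hH hd.monotone)
      (lt_of_not_ge hlt)), coeff_zero]
  have hI0 : ((det H).coeff I).coeff 0 ≠ 0 := by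
    rw [hI, coeff_G_top K₁ K₂ d S e T H hH hd h0, coeff_detQ_zero K₂ e T he, h0]
    exact hJ
  -- the seam edge of the trivial datum is the monomial `F I 0 · X^I`
  set E₂ : ℝ[X] := ∑ i ∈ range (I + 1), ∑ j ∈ range (J + 1),
    C (if 1 * i = 1 * I + 1 * j then ((det H).coeff i).coeff j else 0) * X ^ (i + j) with hE₂
  have hE₂' : E₂ = C (((det H).coeff I).coeff 0) * X ^ (I + 0) := by
    rw [hE₂, Finset.sum_eq_single_of_mem I (by simp)]
    · rw [Finset.sum_eq_single_of_mem 0 (by simp)]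
      · simp
      · intro j _ hj
        have hzero : (if 1 * I = 1 * I + 1 * j then ((det H).coeff I).coeff j else 0) = 0 := by
          rw [if_neg (by omega)]
        rw [hzero, C_0, zero_mul]
    · intro i _ hi
      refine Finset.sum_eq_zero fun j _ => ?_
      by_cases hc : 1 * i = 1 * I + 1 * j
      · have hz : ((det H).coeff i).coeff j = 0 := by
          by_contra hne
          have := hFI i j hne
          omega
        rw [if_pos hc, hz, C_0, zero_mul]
      · rw [if_neg hc, C_0, zero_mul]
  have hcount : E₂.roots.countP (fun t => 0 < t) = 0 := by
    rw [hE₂']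
    exact countP_roots_C_mul_X_pow _ hI0 _
  have h := junction_count_of_seam K₁ K₂ d S e T H hH hd he h0 hS0 hTl I 0 1 1 one_pos one_pos le_rfl
    (Nat.zero_le _) (by rw [← hI]; simp) (fun i j hij => by have := hFI i j hij; omega) hI0 hI0 E₂ hE₂
  refine h.mono fun Λ hΛ => ?_
  rw [hcount, add_zero] at hΛ
  exact hΛ

end Bridge

/-- **NONSINGULAR JUNCTIONS ARE ADDITIVE** — the line's `NonsingularJunctionAdditive m`, all `m`, with the line's
vocabulary `posD / posM / pencil / junction` unfolded (the line file `Cruxes/MatrixDescartes/Lines/junction_ceiling.lean`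
closes it by `exact nonsingularJunctionAdditive m`): if the junction letter `J = S last = T 0` and both far-end letters
`S 0`, `T last` are nonsingular, then eventually in `Λ` the junction pencil `H_Λ` has at most `Z•(det P) + Z•(det Q)`
distinct positive roots (the kernel's floor `ζ_alt(P) + ζ_alt(Q)` is also the ceiling: scale-separated recombination
through nonsingular letters is exactly additive).  Honest framing: a structural statement about ONE construction; it
says nothing about `MatrixDescartes`, Conjecture B or VP ≠ VNP. [folklore] -/
theorem nonsingularJunctionAdditive (m : ℕ) :
    ∀ (K₁ K₂ : ℕ) (d : Fin (K₁ + 1) → ℕ) (S : Fin (K₁ + 1) → Matrix (Fin m) (Fin m) ℝ)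
      (e : Fin (K₂ + 1) → ℕ) (T : Fin (K₂ + 1) → Matrix (Fin m) (Fin m) ℝ),
      StrictMono d → StrictMono e → (∀ l, (S l).IsSymm) → (∀ l, (T l).IsSymm) →
      T 0 = S (Fin.last K₁) → (S 0).det ≠ 0 → (S (Fin.last K₁)).det ≠ 0 → (T (Fin.last K₂)).det ≠ 0 →
      ∀ᶠ Λ : ℝ in atTop,
        ((∑ l : Fin (K₁ + 1) ⊕ Fin K₂,
            (X : ℝ[X]) ^ (Sum.elim d (fun l : Fin K₂ => d (Fin.last K₁) + (e l.succ - e 0)) l) •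
              ((Sum.elim S (fun l : Fin K₂ => (Λ⁻¹) ^ (e l.succ - e 0) • T l.succ) l).map C)).det.roots.toFinset.filter
            (fun t => 0 < t)).card ≤
          (∑ l, (X : ℝ[X]) ^ d l • (S l).map C).det.roots.countP (fun t => 0 < t) +
            (∑ l, (X : ℝ[X]) ^ e l • (T l).map C).det.roots.countP (fun t => 0 < t) := by
  intro K₁ K₂ d S e T hd he _ _ h0 hS0 hJ hTl
  exact junction_additive_of_det_ne_zero K₁ K₂ d S e T
    (Matrix.of fun i k => (∑ l : Fin (K₁ + 1), C (C (S l i k)) * X ^ (d l - d 0)) +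
      ∑ l : Fin K₂, C (C (T l.succ i k) * X ^ (e l.succ - e 0)) * X ^ (d (Fin.last K₁) - d 0))
    (fun i k => rfl) hd he h0 hS0 hJ hTl

end Summit.ValiantsHypothesis.ValiantsHypothesis.Theorems.LacunarySymmetroidMatrixDescartes.JunctionCeiling
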